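import Summits.NavierStokesRegularity.NavierStokesRegularity.Theses.SlicedKelvin
import Summits.NavierStokesRegularity.NavierStokesRegularity.Theorems.AdaptedKernelExists.Negative.UniformDriftKernel
import HarnessLib

/-!
# Crux `SlicedKelvin.FluxZoom` (stmt-NavierStokesRegularity-15603), line `registered`:
# the `L²` hypothesis of `stub_unitScaleVelocity` / `stub_fluxVelocity` is load-bearing

Negative (support) lemmas for the lead's skeleton of the crux `FluxZoom` of route `SlicedKelvin`
(`Cruxes/FluxZoom/Lines/birth.lean`, skeleton `aad79edc…`; extracted from the crux work file
`Cruxes/FluxZoom/Disproof.lean`, cdisprove seat, gen 1, §5).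

The velocity stubs of the vorticity-clock zoom,

* `stub_unitScaleVelocity` : `‖v(x)‖ ≤ r W + 3Φ/(π r) + C_v ‖v‖_{L²}` (`0 < r ≤ 1`), and
* `stub_fluxVelocity`      : `‖v(x)‖² ≤ (12/π) · W · Φ`,

are stated for `C²` divergence-free fields `v ∈ L²(EuclideanSpace ℝ (Fin 3))` with `‖curl v‖ ≤ W` and unsigned flux of
`curl v` through every plane `≤ Φ`.  The hypothesis `v ∈ L²` (`∫⁻ ‖v‖ₑ² < ⊤`) is LOAD-BEARING, and
it can NOT be replaced by mere boundedness of `v` (the natural class of the zoom LIMIT): a constant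
field `v ≡ b`, `‖b‖ = 1`, is `C^∞`, divergence free, bounded, irrotational (`W = 0`) with zero
planar flux (`Φ = 0`), while `‖v(0)‖ = 1 > 0 = (12/π)·0·0 = 1·0 + 3·0/(π·1)`.  (Every bounded
irrotational solenoidal smooth field is constant — KNSS 2009 Lemma 3.1, in tree
`Theorems.PlanarFluxLiouville.Birth.stub_irrotationalConstant` — so the `L²` hypothesis serves
exactly to kill the constants: the scale-invariant bound must be applied to the slices
`u(t) ∈ L²` of the blow-up solution BEFORE rescaling, never to the bounded ancient limit.)
[folklore]
-/

noncomputable section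

-- single-conjunct summit: `<Summit>.<Problem>` repeats the name (tree-wide convention, lakefile weak option)
set_option linter.dupNamespace false

namespace Summit.NavierStokesRegularity.NavierStokesRegularity.Theorems.FluxZoom.Negative

open Set MeasureTheory
open Literature.Analysis.FluidPDE

/-! ## The witness: constant fields

(`VectorCalculus.IsDivFree` of a constant field is the landed
`Theorems.AdaptedKernelExistsNegative.UniformDrift.isDivFree_const`, reused.) -/

/-- The curl of a constant field vanishes (every `fderiv` of a constant is `0`). [folklore] -/
theorem curl_constField (b x : EuclideanSpace ℝ (Fin 3)) : curl (fun _ : EuclideanSpace ℝ (Fin 3) => b) x = 0 := by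
  ext i
  fin_cases i <;> simp [curl]

/-- The vorticity bound `‖curl b‖ ≤ 0` (`W = 0`) for a constant field. [folklore] -/
theorem norm_curl_constField_le (b x : EuclideanSpace ℝ (Fin 3)) : ‖curl (fun _ : EuclideanSpace ℝ (Fin 3) => b) x‖ ≤ 0 := by
  rw [curl_constField, norm_zero]

/-- The planar flux of `curl b = 0` through every plane is `0 ≤ ofReal 0` (`Φ = 0`). [folklore] -/
theorem flux_constField_le (b : EuclideanSpace ℝ (Fin 3)) (R : EuclideanSpace ℝ (Fin 3) ≃ₗᵢ[ℝ] EuclideanSpace ℝ (Fin 3)) (c : ℝ) :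
    ∫⁻ y : EuclideanSpace ℝ (Fin 2), ‖inner ℝ (curl (fun _ : EuclideanSpace ℝ (Fin 3) => b) (R (WithLp.toLp 2 ![y 0, y 1, c])))
        (R (EuclideanSpace.single 2 1))‖ₑ ≤ ENNReal.ofReal 0 := by
  simp [curl_constField]

/-! ## `stub_fluxVelocity` without `v ∈ L²` -/

/-- **`stub_fluxVelocity` is FALSE without `v ∈ L²`.** The CONCLUSION of `stub_fluxVelocity` with
the hypothesis `∫⁻ ‖v‖ₑ² < ⊤` deleted (verbatim otherwise) fails: the constant field `e₀` with
`W = Φ = 0` would have to vanish. Any proof of the stub must use the `L²` hypothesis. [folklore] -/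
theorem stub_fluxVelocity_false_without_L2 :
    ¬ (∀ (v : EuclideanSpace ℝ (Fin 3) → EuclideanSpace ℝ (Fin 3)), ContDiff ℝ 2 v →
        Literature.Analysis.FluidPDE.VectorCalculus.IsDivFree v →
        ∀ (W Φ : ℝ), 0 ≤ W → 0 ≤ Φ →
          (∀ x, ‖Literature.Analysis.FluidPDE.curl v x‖ ≤ W) →
          (∀ (R : EuclideanSpace ℝ (Fin 3) ≃ₗᵢ[ℝ] EuclideanSpace ℝ (Fin 3)) (c : ℝ),
            ∫⁻ y : EuclideanSpace ℝ (Fin 2),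
              ‖inner ℝ (Literature.Analysis.FluidPDE.curl v (R (WithLp.toLp 2 ![y 0, y 1, c])))
                (R (EuclideanSpace.single 2 1))‖ₑ ≤ ENNReal.ofReal Φ) →
          ∀ x, ‖v x‖ ^ 2 ≤ 12 / Real.pi * W * Φ) := by
  intro h
  have key := h (fun _ => EuclideanSpace.single 0 1) contDiff_const (AdaptedKernelExistsNegative.UniformDrift.isDivFree_const _) 0 0
    le_rfl le_rfl (norm_curl_constField_le _) (flux_constField_le _) 0
  have he : ‖(EuclideanSpace.single 0 1 : EuclideanSpace ℝ (Fin 3))‖ = 1 := by simp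
  rw [he] at key
  norm_num at key

/-- **Boundedness cannot replace `L²` in `stub_fluxVelocity`.** With `v ∈ L²` REPLACED by
`∃ C, ∀ x, ‖v x‖ ≤ C` (the class of bounded ancient mild solutions, i.e. of the zoom limit) the
conclusion fails for the same constant witness. So `‖v‖²_∞ ≤ (12/π)‖curl v‖_∞ · sup-flux` is NOT
available on the bounded ancient limit of the zoom; it must be fed in before rescaling. [folklore] -/
theorem stub_fluxVelocity_false_with_bounded_for_L2 :
    ¬ (∀ (v : EuclideanSpace ℝ (Fin 3) → EuclideanSpace ℝ (Fin 3)), ContDiff ℝ 2 v →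
        Literature.Analysis.FluidPDE.VectorCalculus.IsDivFree v →
        (∃ C : ℝ, ∀ x, ‖v x‖ ≤ C) →
        ∀ (W Φ : ℝ), 0 ≤ W → 0 ≤ Φ →
          (∀ x, ‖Literature.Analysis.FluidPDE.curl v x‖ ≤ W) →
          (∀ (R : EuclideanSpace ℝ (Fin 3) ≃ₗᵢ[ℝ] EuclideanSpace ℝ (Fin 3)) (c : ℝ),
            ∫⁻ y : EuclideanSpace ℝ (Fin 2),
              ‖inner ℝ (Literature.Analysis.FluidPDE.curl v (R (WithLp.toLp 2 ![y 0, y 1, c])))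
                (R (EuclideanSpace.single 2 1))‖ₑ ≤ ENNReal.ofReal Φ) →
          ∀ x, ‖v x‖ ^ 2 ≤ 12 / Real.pi * W * Φ) := by
  intro h
  have hb : ∃ C : ℝ, ∀ x : EuclideanSpace ℝ (Fin 3),
      ‖(fun _ : EuclideanSpace ℝ (Fin 3) => (EuclideanSpace.single 0 1 : EuclideanSpace ℝ (Fin 3))) x‖ ≤ C :=
    ⟨1, fun _ => by simp⟩
  have key := h (fun _ => EuclideanSpace.single 0 1) contDiff_const (AdaptedKernelExistsNegative.UniformDrift.isDivFree_const _) hb 0 0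
    le_rfl le_rfl (norm_curl_constField_le _) (flux_constField_le _) 0
  have he : ‖(EuclideanSpace.single 0 1 : EuclideanSpace ℝ (Fin 3))‖ = 1 := by simp
  rw [he] at key
  norm_num at key

/-! ## `stub_unitScaleVelocity` without the energy term -/

/-- **`stub_unitScaleVelocity` is FALSE without the `L²` term.** The CONCLUSION of
`stub_unitScaleVelocity` with the energy term `C_v ‖v‖_{L²}` (and the hypothesis `v ∈ L²`) deleted,
`‖v(x)‖ ≤ r W + 3Φ/(π r)` for `0 < r ≤ 1`, fails at `r = 1`, `W = Φ = 0` for the constant field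
`e₀` (`1 ≤ 0`). The cut-off terms of the local Helmholtz identity (`∇φ × v`, `⟪v, ∇φ⟫` on the shell
`1 ≤ |x − y| ≤ 2`) are exactly where the constants live. [folklore] -/
theorem stub_unitScaleVelocity_false_without_L2 :
    ¬ (∀ (v : EuclideanSpace ℝ (Fin 3) → EuclideanSpace ℝ (Fin 3)), ContDiff ℝ 2 v →
        Literature.Analysis.FluidPDE.VectorCalculus.IsDivFree v →
        ∀ (W Φ : ℝ), 0 ≤ W → 0 ≤ Φ →
          (∀ x, ‖Literature.Analysis.FluidPDE.curl v x‖ ≤ W) →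
          (∀ (R : EuclideanSpace ℝ (Fin 3) ≃ₗᵢ[ℝ] EuclideanSpace ℝ (Fin 3)) (c : ℝ),
            ∫⁻ y : EuclideanSpace ℝ (Fin 2),
              ‖inner ℝ (Literature.Analysis.FluidPDE.curl v (R (WithLp.toLp 2 ![y 0, y 1, c])))
                (R (EuclideanSpace.single 2 1))‖ₑ ≤ ENNReal.ofReal Φ) →
          ∀ (x : EuclideanSpace ℝ (Fin 3)) (r : ℝ), 0 < r → r ≤ 1 →
            ‖v x‖ ≤ r * W + 3 * Φ / (Real.pi * r)) := by
  intro h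
  have key := h (fun _ => EuclideanSpace.single 0 1) contDiff_const (AdaptedKernelExistsNegative.UniformDrift.isDivFree_const _) 0 0
    le_rfl le_rfl (norm_curl_constField_le _) (flux_constField_le _) 0 1 one_pos le_rfl
  have he : ‖(EuclideanSpace.single 0 1 : EuclideanSpace ℝ (Fin 3))‖ = 1 := by simp
  rw [he] at key
  norm_num at key

end Summit.NavierStokesRegularity.NavierStokesRegularity.Theorems.FluxZoom.Negative

end
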